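import Literature.AlgebraicGeometry.HodgeTheory.HomComplexSigmaDinatural
import HarnessLib

/-!
# The semiregularity map of a vector bundle is dinatural — Buchweitz–Flenner 2003, Cor. 4.8 in degree `(0, 2)`, module level;
# semiregularity of direct sums of vector bundles

Family `hodge`, layer `Literature/AlgebraicGeometry/HodgeTheory`; companion of `HomComplexSigmaDinatural.lean` (the same
statements for strictly perfect complexes, from which everything here is transported along the landed anchor
`HomComplex.sigmaCoh_single : σ_q^C(E[0])(x.hom) = σ_q(E)(x)` of `HomComplexSigmaSingle.lean`, in Mathlib's standard derived
category — the statements below do not depend on that choice). Cross-ladder literature-typing tranche LT-H1 «semiregularity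
consumers» (cell `pub-hsemireg`, home `s4push/lit-semireg/`). PROVED throughout — no named fact, no definition, no instance.
Carriers: the tree's REAL `sigmaHigher hE q : Ext²(E, E) →+ H^{q+2}(X, Ω^q)` and `IsISemiregular hE I`
(`SemiregularityHigherSigma.lean`) for a finite locally free `𝒪_X`-module `E` on an `S`-scheme `X`. Nothing here is a claim
about any conjecture; nothing asserts HC ∕ HC_AV ∕ W₆ ∕ HC_Kum4Type.

## Source, verbatim

[BuchweitzFlenner2003] Compositio Math. 137 (2003) (= arXiv:math∕9912245), §4, paragraph before Cor. 4.8
[corpus:paper:arxiv-math_9912245 p0022:L34–48] («Centrality of the Atiyah classes together with the fact that the trace vanishes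
on commutators implies then the following result.») and **Corollary 4.8** [p0022:L50–65]: «The family of semiregularity maps
`σ : Ext^r_X(𝓕, 𝓕) → ∏_k H^{k+r}(X, Λ^k 𝕃_{X∕Y})`, `r ≥ 0`, vanishes on `[Ext^•_X(𝓕, 𝓕), Ext^•_X(𝓕, 𝓕)] ⊆ Ext^•_X(𝓕, 𝓕)`.»
(`[ξ, ζ] := ξζ − (−1)^{ij} ζξ`). GRADE: REFEREED. Full quotation and the faithfulness discussion: module docstring of
`HomComplexSigmaDinatural.lean`.

## What is here

* §1 `sigmaHigher_dinatural` — for `g : E₁ ⟶ E₂` between finite locally free modules and `y ∈ Ext²(E₂, E₁)`,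
  `σ_q^{E₁}(g · y) = σ_q^{E₂}(y · g)`; `sigmaHigher_commutator_eq_zero` — Cor. 4.8 for `(i, j) = (0, 2)` as printed
  (`σ_q(g · y − y · g) = 0`, `g ∈ Hom(E, E) = Ext⁰`); `sigmaHigher_eq_zero_of_comp_eq_zero` — classes `p · y · i` with
  `i ≫ p = 0` lie in `ker σ_q`.
* §2 Direct sums `E₁ ⊞ E₂` of vector bundles (finite locally free by `KTheory.KZero.isFiniteLocallyFree_biprod`; the theorems take
  any proof `hB`): the off-diagonal blocks of `Ext²(E₁ ⊞ E₂, E₁ ⊞ E₂)` lie in `⋂_q ker σ_q` (`sigmaHigher_biprod_fst_inr_eq_zero`,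
  `sigmaHigher_biprod_snd_inl_eq_zero`); **an `I`-semiregular `E₁ ⊞ E₂` has `Ext²(E₁, E₂) = 0 = Ext²(E₂, E₁)`**
  (`IsISemiregular.eq_zero_of_biprod₁₂` ∕ `₂₁` — by-name form of «a direct sum of semiregular sheaves is semiregular only if the
  cross `Ext²` vanish»); the diagonal blocks carry `σ_q^{E₁}`, `σ_q^{E₂}` (`sigmaHigher_biprod_fst_inl`, `_snd_inr`), so
  **direct summands of an `I`-semiregular bundle are `I`-semiregular** (`IsISemiregular.biprod_fst` ∕ `_snd`); and
  **`σ_q^{E₁ ⊞ E₂}(x) = σ_q^{E₁}(inl · x · fst) + σ_q^{E₂}(inr · x · snd)`** (`sigmaHigher_biprod_eq_add`).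

## Faithfulness sheet

* `sigmaHigher_dinatural` — STRONGER than the `(0, 2)` part of Cor. 4.8 (two objects); `sigmaHigher_commutator_eq_zero` —
  FAITHFUL to Cor. 4.8 at `(i, j) = (0, 2)`. REFEREED. NOT here (carrier gap, as in the companion file): the bracket
  `[Ext¹, Ext¹]` («obstructions to second order») and `r ≠ 2`.
* §2 — consequences of Cor. 4.8, not separately in print (presearch: corpus fts+vec, galaxy — no hit); tagged
  `[cite: BuchweitzFlenner2003, Cor. 4.8 (consequence)]`.
-/

noncomputable section

open CategoryTheory CategoryTheory.Limits AlgebraicGeometry Opposite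

namespace Literature.AlgebraicGeometry.HodgeTheory

open Literature.AlgebraicGeometry.Modules Literature.AlgebraicGeometry.Motives

/-! ## §1 Dinaturality and [BF03, Cor. 4.8] in degree `(0, 2)` for vector bundles -/

section Modules

universe u

variable {S : Type u} [CommRing S] {X : Over (Spec (CommRingCat.of S))}

/-- The terms of the single complex `E[0]` of a finite locally free module are finite locally free (`E` in degree `0`, zero
elsewhere) — a vector bundle placed in degree `0` is a strictly perfect complex («Recall that a complex `𝓕` over a complex
space `X` is called perfect if it admits locally a quasiisomorphism to a bounded complex of free coherent `𝒪_X`–modules»,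
followed by: a module on a complex manifold, considered as a complex concentrated in degree `0`, is perfect — BF §4
[corpus:paper:arxiv-math_9912245 p0020:L5–8]; for modules on arbitrary complex spaces the scope is «any coherent
`𝒪_X`–module `𝓕` of locally finite projective dimension, or even for perfect complexes of modules» [p0003:L35–37]).
[cite: BuchweitzFlenner2003, §4 (before Def. 4.1: modules as perfect complexes)] -/
theorem isFiniteLocallyFree_single₀_X (E : X.left.Modules) (hE : IsFiniteLocallyFree E) (p : ℤ) :
    IsFiniteLocallyFree ((HomComplex.single₀ X.left E).X p) := by
  by_cases hp : p = 0
  · subst hp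
    exact isFiniteLocallyFree_of_iso (HomologicalComplex.singleObjXSelf (ComplexShape.up ℤ) 0 E).symm hE
  · exact KTheory.KZero.isFiniteLocallyFree_of_isZero
      (HomologicalComplex.isZero_single_obj_X (ComplexShape.up ℤ) 0 E p hp)

variable {E E₁ E₂ : X.left.Modules}

set_option backward.isDefEq.respectTransparency false in
/-- **`σ_q` of vector bundles is dinatural** ([BF03, Cor. 4.8] in degree `(0, 2)`, two-object form, module level): for
`g : E₁ ⟶ E₂` between finite locally free `𝒪_X`-modules and `y ∈ Ext²(E₂, E₁)`, `σ_q^{E₁}(g · y) = σ_q^{E₂}(y · g)` in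
`H^{q+2}(X, Ω^q)` — transported from `HomComplex.sigmaC_dinatural` for `g[0] : E₁[0] ⟶ E₂[0]` along the anchor
`HomComplex.sigmaCoh_single` (in Mathlib's standard derived category; the statement does not depend on that choice).
[cite: BuchweitzFlenner2003, Cor. 4.8 and §4 (paragraph before Cor. 4.8)] -/
theorem sigmaHigher_dinatural (hE₁ : IsFiniteLocallyFree E₁) (hE₂ : IsFiniteLocallyFree E₂) (g : E₁ ⟶ E₂) (q : ℕ)
    (y : Abelian.Ext E₂ E₁ 2) :
    sigmaHigher hE₁ q ((Abelian.Ext.mk₀ g).comp y (zero_add 2)) =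
      sigmaHigher hE₂ q (y.comp (Abelian.Ext.mk₀ g) (add_zero 2)) := by
  letI := HasDerivedCategory.standard X.left.Modules
  haveI : (HomComplex.single₀ X.left E₁).IsStrictlyGE 0 :=
    inferInstanceAs (((CochainComplex.singleFunctor X.left.Modules 0).obj E₁).IsStrictlyGE 0)
  haveI : (HomComplex.single₀ X.left E₁).IsStrictlyLE 0 :=
    inferInstanceAs (((CochainComplex.singleFunctor X.left.Modules 0).obj E₁).IsStrictlyLE 0)
  haveI : (HomComplex.single₀ X.left E₂).IsStrictlyGE 0 :=
    inferInstanceAs (((CochainComplex.singleFunctor X.left.Modules 0).obj E₂).IsStrictlyGE 0)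
  haveI : (HomComplex.single₀ X.left E₂).IsStrictlyLE 0 :=
    inferInstanceAs (((CochainComplex.singleFunctor X.left.Modules 0).obj E₂).IsStrictlyLE 0)
  rw [← HomComplex.sigmaCoh_single X E₁ hE₁ (isFiniteLocallyFree_single₀_X E₁ hE₁) q,
    ← HomComplex.sigmaCoh_single X E₂ hE₂ (isFiniteLocallyFree_single₀_X E₂ hE₂) q,
    HomComplex.sigmaCoh, HomComplex.sigmaCoh, HomComplex.sigmaExt, HomComplex.sigmaExt, Abelian.Ext.comp_hom,
    Abelian.Ext.comp_hom, Abelian.Ext.mk₀_hom]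
  congr 2
  exact HomComplex.sigmaC_dinatural X 0 0 (isFiniteLocallyFree_single₀_X E₁ hE₁) (isFiniteLocallyFree_single₀_X E₂ hE₂)
    ((HomologicalComplex.single X.left.Modules (ComplexShape.up ℤ) 0).map g) q y.hom

/-- **[BF03, Cor. 4.8] in degree `(0, 2)` for a vector bundle, as printed**: `σ_q(g · y − y · g) = 0` for `g ∈ Hom(E, E) = Ext⁰`
and `y ∈ Ext²(E, E)`. [cite: BuchweitzFlenner2003, Cor. 4.8] -/
theorem sigmaHigher_commutator_eq_zero (hE : IsFiniteLocallyFree E) (g : E ⟶ E) (q : ℕ) (y : Abelian.Ext E E 2) :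
    sigmaHigher hE q ((Abelian.Ext.mk₀ g).comp y (zero_add 2) - y.comp (Abelian.Ext.mk₀ g) (add_zero 2)) = 0 := by
  rw [map_sub, sub_eq_zero]
  exact sigmaHigher_dinatural hE hE g q y

/-- **Off-diagonal vanishing for vector bundles**: if `i : E₂ ⟶ E` and `p : E ⟶ E₁` compose to zero (`E`, `E₂` finite locally
free), then `σ_q^{E}(p · y · i) = 0` for every `y ∈ Ext²(E₁, E₂)`. [cite: BuchweitzFlenner2003, Cor. 4.8 (consequence)] -/
theorem sigmaHigher_eq_zero_of_comp_eq_zero (hE : IsFiniteLocallyFree E) (hE₂ : IsFiniteLocallyFree E₂)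
    (p : E ⟶ E₁) (i : E₂ ⟶ E) (h : i ≫ p = 0) (q : ℕ) (y : Abelian.Ext E₁ E₂ 2) :
    sigmaHigher hE q ((Abelian.Ext.mk₀ p).comp (y.comp (Abelian.Ext.mk₀ i) (add_zero 2)) (zero_add 2)) = 0 := by
  rw [← Abelian.Ext.comp_assoc_of_third_deg_zero,
    ← sigmaHigher_dinatural hE₂ hE i q ((Abelian.Ext.mk₀ p).comp y (zero_add 2)), Abelian.Ext.mk₀_comp_mk₀_assoc, h,
    Abelian.Ext.mk₀_zero, Abelian.Ext.zero_comp, map_zero]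

/-! ## §2 Direct sums of vector bundles -/

/-- **The block `Ext²(E₁, E₂) ↪ Ext²(E₁ ⊞ E₂, E₁ ⊞ E₂)`, `y ↦ fst · y · inr`, lies in `ker σ_q`** for every `q` and any proof
`hB` that `E₁ ⊞ E₂` is finite locally free (e.g. `KTheory.KZero.isFiniteLocallyFree_biprod`). [cite: BuchweitzFlenner2003, Cor. 4.8 (consequence)] -/
theorem sigmaHigher_biprod_fst_inr_eq_zero (hB : IsFiniteLocallyFree (E₁ ⊞ E₂)) (hE₂ : IsFiniteLocallyFree E₂) (q : ℕ)
    (y : Abelian.Ext E₁ E₂ 2) :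
    sigmaHigher hB q ((Abelian.Ext.mk₀ (biprod.fst : E₁ ⊞ E₂ ⟶ E₁)).comp
      (y.comp (Abelian.Ext.mk₀ (biprod.inr : E₂ ⟶ E₁ ⊞ E₂)) (add_zero 2)) (zero_add 2)) = 0 :=
  sigmaHigher_eq_zero_of_comp_eq_zero hB hE₂ biprod.fst biprod.inr biprod.inr_fst q y

/-- The other block `Ext²(E₂, E₁)`, `y ↦ snd · y · inl`, lies in `ker σ_q`. [cite: BuchweitzFlenner2003, Cor. 4.8 (consequence)] -/
theorem sigmaHigher_biprod_snd_inl_eq_zero (hB : IsFiniteLocallyFree (E₁ ⊞ E₂)) (hE₁ : IsFiniteLocallyFree E₁) (q : ℕ)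
    (y : Abelian.Ext E₂ E₁ 2) :
    sigmaHigher hB q ((Abelian.Ext.mk₀ (biprod.snd : E₁ ⊞ E₂ ⟶ E₂)).comp
      (y.comp (Abelian.Ext.mk₀ (biprod.inl : E₁ ⟶ E₁ ⊞ E₂)) (add_zero 2)) (zero_add 2)) = 0 :=
  sigmaHigher_eq_zero_of_comp_eq_zero hB hE₁ biprod.snd biprod.inl biprod.inl_snd q y

/-- **An `I`-semiregular direct sum of vector bundles has `Ext²(E₁, E₂) = 0`** (any `I`): the block `fst · y · inr` lies in the
joint kernel of `(σ_q)_{q ∈ I}` and `y = inl · (fst · y · inr) · snd`. By-name form of «a direct sum of semiregular sheaves is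
semiregular only if the cross `Ext²` vanish». [cite: BuchweitzFlenner2003, Cor. 4.8 (consequence) and §5 (I-semiregular)] -/
theorem IsISemiregular.eq_zero_of_biprod₁₂ {hB : IsFiniteLocallyFree (E₁ ⊞ E₂)} {I : Set ℕ} (h : IsISemiregular hB I)
    (hE₂ : IsFiniteLocallyFree E₂) (y : Abelian.Ext E₁ E₂ 2) : y = 0 := by
  have hx : (Abelian.Ext.mk₀ (biprod.fst : E₁ ⊞ E₂ ⟶ E₁)).comp
      (y.comp (Abelian.Ext.mk₀ (biprod.inr : E₂ ⟶ E₁ ⊞ E₂)) (add_zero 2)) (zero_add 2) = 0 :=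
    h _ fun q _ => sigmaHigher_biprod_fst_inr_eq_zero hB hE₂ q y
  have key : y = (Abelian.Ext.mk₀ (biprod.inl : E₁ ⟶ E₁ ⊞ E₂)).comp
      (((Abelian.Ext.mk₀ (biprod.fst : E₁ ⊞ E₂ ⟶ E₁)).comp
          (y.comp (Abelian.Ext.mk₀ (biprod.inr : E₂ ⟶ E₁ ⊞ E₂)) (add_zero 2)) (zero_add 2)).comp
        (Abelian.Ext.mk₀ (biprod.snd : E₁ ⊞ E₂ ⟶ E₂)) (add_zero 2)) (zero_add 2) := by
    rw [Abelian.Ext.comp_assoc_of_third_deg_zero, Abelian.Ext.mk₀_comp_mk₀_assoc, biprod.inl_fst, Abelian.Ext.mk₀_id_comp,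
      Abelian.Ext.comp_assoc_of_third_deg_zero, Abelian.Ext.mk₀_comp_mk₀, biprod.inr_snd, Abelian.Ext.comp_mk₀_id]
  calc y = _ := key
    _ = 0 := by rw [hx, Abelian.Ext.zero_comp, Abelian.Ext.comp_zero]

/-- **An `I`-semiregular direct sum of vector bundles has `Ext²(E₂, E₁) = 0`.**
[cite: BuchweitzFlenner2003, Cor. 4.8 (consequence) and §5 (I-semiregular)] -/
theorem IsISemiregular.eq_zero_of_biprod₂₁ {hB : IsFiniteLocallyFree (E₁ ⊞ E₂)} {I : Set ℕ} (h : IsISemiregular hB I)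
    (hE₁ : IsFiniteLocallyFree E₁) (y : Abelian.Ext E₂ E₁ 2) : y = 0 := by
  have hx : (Abelian.Ext.mk₀ (biprod.snd : E₁ ⊞ E₂ ⟶ E₂)).comp
      (y.comp (Abelian.Ext.mk₀ (biprod.inl : E₁ ⟶ E₁ ⊞ E₂)) (add_zero 2)) (zero_add 2) = 0 :=
    h _ fun q _ => sigmaHigher_biprod_snd_inl_eq_zero hB hE₁ q y
  have key : y = (Abelian.Ext.mk₀ (biprod.inr : E₂ ⟶ E₁ ⊞ E₂)).comp
      (((Abelian.Ext.mk₀ (biprod.snd : E₁ ⊞ E₂ ⟶ E₂)).comp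
          (y.comp (Abelian.Ext.mk₀ (biprod.inl : E₁ ⟶ E₁ ⊞ E₂)) (add_zero 2)) (zero_add 2)).comp
        (Abelian.Ext.mk₀ (biprod.fst : E₁ ⊞ E₂ ⟶ E₁)) (add_zero 2)) (zero_add 2) := by
    rw [Abelian.Ext.comp_assoc_of_third_deg_zero, Abelian.Ext.mk₀_comp_mk₀_assoc, biprod.inr_snd, Abelian.Ext.mk₀_id_comp,
      Abelian.Ext.comp_assoc_of_third_deg_zero, Abelian.Ext.mk₀_comp_mk₀, biprod.inl_fst, Abelian.Ext.comp_mk₀_id]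
  calc y = _ := key
    _ = 0 := by rw [hx, Abelian.Ext.zero_comp, Abelian.Ext.comp_zero]

/-- **`σ_q` of a direct summand is read off the sum, first summand**: `σ_q^{E₁ ⊞ E₂}(fst · y · inl) = σ_q^{E₁}(y)` for
`y ∈ Ext²(E₁, E₁)` (dinaturality along `fst`, `inl ≫ fst = 𝟙`). [cite: BuchweitzFlenner2003, Cor. 4.8 (consequence)] -/
theorem sigmaHigher_biprod_fst_inl (hB : IsFiniteLocallyFree (E₁ ⊞ E₂)) (hE₁ : IsFiniteLocallyFree E₁) (q : ℕ)
    (y : Abelian.Ext E₁ E₁ 2) :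
    sigmaHigher hB q ((Abelian.Ext.mk₀ (biprod.fst : E₁ ⊞ E₂ ⟶ E₁)).comp
      (y.comp (Abelian.Ext.mk₀ (biprod.inl : E₁ ⟶ E₁ ⊞ E₂)) (add_zero 2)) (zero_add 2)) = sigmaHigher hE₁ q y := by
  rw [sigmaHigher_dinatural hB hE₁ biprod.fst q, Abelian.Ext.comp_assoc_of_third_deg_zero, Abelian.Ext.mk₀_comp_mk₀,
    biprod.inl_fst, Abelian.Ext.comp_mk₀_id]

/-- **`σ_q` of a direct summand is read off the sum, second summand**: `σ_q^{E₁ ⊞ E₂}(snd · y · inr) = σ_q^{E₂}(y)`.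
[cite: BuchweitzFlenner2003, Cor. 4.8 (consequence)] -/
theorem sigmaHigher_biprod_snd_inr (hB : IsFiniteLocallyFree (E₁ ⊞ E₂)) (hE₂ : IsFiniteLocallyFree E₂) (q : ℕ)
    (y : Abelian.Ext E₂ E₂ 2) :
    sigmaHigher hB q ((Abelian.Ext.mk₀ (biprod.snd : E₁ ⊞ E₂ ⟶ E₂)).comp
      (y.comp (Abelian.Ext.mk₀ (biprod.inr : E₂ ⟶ E₁ ⊞ E₂)) (add_zero 2)) (zero_add 2)) = sigmaHigher hE₂ q y := by
  rw [sigmaHigher_dinatural hB hE₂ biprod.snd q, Abelian.Ext.comp_assoc_of_third_deg_zero, Abelian.Ext.mk₀_comp_mk₀,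
    biprod.inr_snd, Abelian.Ext.comp_mk₀_id]

/-- **A direct summand of an `I`-semiregular vector bundle is `I`-semiregular, first summand**: `y ↦ fst · y · inl` is injective
`Ext²(E₁, E₁) → Ext²(E₁ ⊞ E₂, E₁ ⊞ E₂)` and intertwines `σ_q` (`sigmaHigher_biprod_fst_inl`).
[cite: BuchweitzFlenner2003, Cor. 4.8 (consequence) and §5 (I-semiregular)] -/
theorem IsISemiregular.biprod_fst {hB : IsFiniteLocallyFree (E₁ ⊞ E₂)} {I : Set ℕ} (h : IsISemiregular hB I)
    (hE₁ : IsFiniteLocallyFree E₁) : IsISemiregular hE₁ I := by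
  intro y hy
  have hx : (Abelian.Ext.mk₀ (biprod.fst : E₁ ⊞ E₂ ⟶ E₁)).comp
      (y.comp (Abelian.Ext.mk₀ (biprod.inl : E₁ ⟶ E₁ ⊞ E₂)) (add_zero 2)) (zero_add 2) = 0 :=
    h _ fun q hq => (sigmaHigher_biprod_fst_inl hB hE₁ q y).trans (hy q hq)
  have key : y = (Abelian.Ext.mk₀ (biprod.inl : E₁ ⟶ E₁ ⊞ E₂)).comp
      (((Abelian.Ext.mk₀ (biprod.fst : E₁ ⊞ E₂ ⟶ E₁)).comp
          (y.comp (Abelian.Ext.mk₀ (biprod.inl : E₁ ⟶ E₁ ⊞ E₂)) (add_zero 2)) (zero_add 2)).comp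
        (Abelian.Ext.mk₀ (biprod.fst : E₁ ⊞ E₂ ⟶ E₁)) (add_zero 2)) (zero_add 2) := by
    rw [Abelian.Ext.comp_assoc_of_third_deg_zero, Abelian.Ext.mk₀_comp_mk₀_assoc, biprod.inl_fst, Abelian.Ext.mk₀_id_comp,
      Abelian.Ext.comp_assoc_of_third_deg_zero, Abelian.Ext.mk₀_comp_mk₀, biprod.inl_fst, Abelian.Ext.comp_mk₀_id]
  calc y = _ := key
    _ = 0 := by rw [hx, Abelian.Ext.zero_comp, Abelian.Ext.comp_zero]

/-- **A direct summand of an `I`-semiregular vector bundle is `I`-semiregular, second summand.**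
[cite: BuchweitzFlenner2003, Cor. 4.8 (consequence) and §5 (I-semiregular)] -/
theorem IsISemiregular.biprod_snd {hB : IsFiniteLocallyFree (E₁ ⊞ E₂)} {I : Set ℕ} (h : IsISemiregular hB I)
    (hE₂ : IsFiniteLocallyFree E₂) : IsISemiregular hE₂ I := by
  intro y hy
  have hx : (Abelian.Ext.mk₀ (biprod.snd : E₁ ⊞ E₂ ⟶ E₂)).comp
      (y.comp (Abelian.Ext.mk₀ (biprod.inr : E₂ ⟶ E₁ ⊞ E₂)) (add_zero 2)) (zero_add 2) = 0 :=
    h _ fun q hq => (sigmaHigher_biprod_snd_inr hB hE₂ q y).trans (hy q hq)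
  have key : y = (Abelian.Ext.mk₀ (biprod.inr : E₂ ⟶ E₁ ⊞ E₂)).comp
      (((Abelian.Ext.mk₀ (biprod.snd : E₁ ⊞ E₂ ⟶ E₂)).comp
          (y.comp (Abelian.Ext.mk₀ (biprod.inr : E₂ ⟶ E₁ ⊞ E₂)) (add_zero 2)) (zero_add 2)).comp
        (Abelian.Ext.mk₀ (biprod.snd : E₁ ⊞ E₂ ⟶ E₂)) (add_zero 2)) (zero_add 2) := by
    rw [Abelian.Ext.comp_assoc_of_third_deg_zero, Abelian.Ext.mk₀_comp_mk₀_assoc, biprod.inr_snd, Abelian.Ext.mk₀_id_comp,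
      Abelian.Ext.comp_assoc_of_third_deg_zero, Abelian.Ext.mk₀_comp_mk₀, biprod.inr_snd, Abelian.Ext.comp_mk₀_id]
  calc y = _ := key
    _ = 0 := by rw [hx, Abelian.Ext.zero_comp, Abelian.Ext.comp_zero]

/-- **`σ_q` of a direct sum of vector bundles splits over the diagonal blocks**: for `x ∈ Ext²(E₁ ⊞ E₂, E₁ ⊞ E₂)`,
`σ_q^{E₁ ⊞ E₂}(x) = σ_q^{E₁}(inl · x · fst) + σ_q^{E₂}(inr · x · snd)` (`x = x · (fst ≫ inl) + x · (snd ≫ inr)`, additivity,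
dinaturality along `inl`, `inr`). Together with `eq_zero_of_biprod₁₂ ∕ ₂₁` and `biprod_fst ∕ _snd`: `E₁ ⊞ E₂` is `I`-semiregular
iff both summands are, the cross `Ext²` vanish, and the `σ_I`-images of `Ext²(E₁, E₁)` and `Ext²(E₂, E₂)` meet only in `0`.
[cite: BuchweitzFlenner2003, Cor. 4.8 (consequence) and Def. 4.1] -/
theorem sigmaHigher_biprod_eq_add (hB : IsFiniteLocallyFree (E₁ ⊞ E₂)) (hE₁ : IsFiniteLocallyFree E₁)
    (hE₂ : IsFiniteLocallyFree E₂) (q : ℕ) (x : Abelian.Ext (E₁ ⊞ E₂) (E₁ ⊞ E₂) 2) :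
    sigmaHigher hB q x =
      sigmaHigher hE₁ q ((Abelian.Ext.mk₀ (biprod.inl : E₁ ⟶ E₁ ⊞ E₂)).comp
          (x.comp (Abelian.Ext.mk₀ (biprod.fst : E₁ ⊞ E₂ ⟶ E₁)) (add_zero 2)) (zero_add 2)) +
        sigmaHigher hE₂ q ((Abelian.Ext.mk₀ (biprod.inr : E₂ ⟶ E₁ ⊞ E₂)).comp
          (x.comp (Abelian.Ext.mk₀ (biprod.snd : E₁ ⊞ E₂ ⟶ E₂)) (add_zero 2)) (zero_add 2)) := by
  have hx : x = (x.comp (Abelian.Ext.mk₀ (biprod.fst : E₁ ⊞ E₂ ⟶ E₁)) (add_zero 2)).comp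
        (Abelian.Ext.mk₀ (biprod.inl : E₁ ⟶ E₁ ⊞ E₂)) (add_zero 2) +
      (x.comp (Abelian.Ext.mk₀ (biprod.snd : E₁ ⊞ E₂ ⟶ E₂)) (add_zero 2)).comp
        (Abelian.Ext.mk₀ (biprod.inr : E₂ ⟶ E₁ ⊞ E₂)) (add_zero 2) := by
    rw [Abelian.Ext.comp_assoc_of_third_deg_zero, Abelian.Ext.comp_assoc_of_third_deg_zero, Abelian.Ext.mk₀_comp_mk₀,
      Abelian.Ext.mk₀_comp_mk₀, ← Abelian.Ext.comp_add, ← Abelian.Ext.mk₀_add, biprod.total, Abelian.Ext.comp_mk₀_id]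
  rw [hx, map_add, ← sigmaHigher_dinatural hE₁ hB biprod.inl q, ← sigmaHigher_dinatural hE₂ hB biprod.inr q, ← hx]

end Modules

end Literature.AlgebraicGeometry.HodgeTheory

end
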